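import Literature.MathematicalPhysics.KineticTheory.HardSphereEuler
import Literature.Analysis.FluidPDE.HardSpherePhaseSpace
import Literature.Analysis.FluidPDE.LambertCosineLaw
import Literature.Analysis.FluidPDE.BallMoments
import Literature.MathematicalPhysics.KineticTheory.LinearLorentzBoltzmannDuality
import Mathlib.Analysis.InnerProductSpace.Projection.Reflection
import HarnessLib

/-!
# Stub S4 `stub_collisionEquipartition` of crux stmt-AtomisticToContinuum-13080
(`JParityClosure.RateFloor`, line `Sketch`): the hard-sphere collision equipartition identity

Registered stub `stub_collisionEquipartition` of the lead's skeleton of the line `Sketch` for the crux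
`Summit.AtomisticToContinuum.HydrodynamicLimit.Theses.JParityClosure.RateFloor`:

  `∫_{S²} (‖v′‖² − ‖v‖²) ((w − v)·ω)₊ dσ(ω) = (π/2) ‖w − v‖ (‖w‖² − ‖v‖²)`,

where `v′ = (reflectVel ω (v, w)).1` is the post-collisional velocity of particle 1, `((w − v)·ω)₊` is
`hardSphereKernel (w, v) ω` and `σ = sphereMeasure = volume.toSphere` (total mass `4π`).

Proof.  Pointwise `‖v′‖² − ‖v‖² = ⟪w − v, ω⟫ ⟪v + w, ω⟫` (`norm_sq_reflectVel_fst_sub`).  With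
`g = w − v = ‖g‖ e`, `a = v + w = ⟪a, e⟫ e + b`, `⟪b, e⟫ = 0`, the integrand is
`‖g‖² ⟪a, e⟫ (⟪e, ω⟫)₊³ + ‖g‖² ⟪e, ω⟫ ⟪b, ω⟫ (⟪e, ω⟫)₊`.  The second term integrates to zero: the
reflection in the hyperplane `b^⊥` is a linear isometry preserving `σ` (`integral_sphere_comp_isometry`),
fixing `⟪e, ω⟫` and flipping `⟪b, ω⟫`.  The cubic half-moment `∫ (⟪e, ω⟫)₊³ dσ = π/2` follows from the
tree's flux form of Archimedes' hat-box theorem (`lintegral_toSphere_cos_comp_coords`: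
`∫ ⟪e, ν⟫₊ f(coords e ν) dσ = ∫_{‖p‖<1} f`) with `f(p) = 1 − ‖p‖²` (on the sphere
`1 − ‖coords e ν‖² = ⟪e, ν⟫²`) and the disc moment `∫_{‖p‖<1} ‖p‖² = π/2` (`integral_ball_norm_sq`).
Finally `‖g‖² ⟪a, e⟫ = ‖g‖ ⟪v + w, w − v⟫ = ‖g‖ (‖w‖² − ‖v‖²)`. [folklore]
-/

noncomputable section

namespace Summit.AtomisticToContinuum.HydrodynamicLimit.Theorems

open MeasureTheory Set Filter Topology Metric
open scoped InnerProductSpace RealInnerProductSpace ENNReal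
open Literature.Analysis.FluidPDE Literature.MathematicalPhysics.KineticTheory

namespace RateFloorCollisionEquipartition

/-! ## Generalities on the sphere measure of `S² ⊆ ℝ³` -/

/-- Continuous functions on the unit sphere of `ℝ³` are integrable for `sphereMeasure`. [folklore] -/
theorem integrable_sph {f : sphere (0 : V3) 1 → ℝ} (hf : Continuous f) :
    Integrable f (sphereMeasure : Measure (sphere (0 : V3) 1)) := by
  haveI : IsFiniteMeasure (sphereMeasure : Measure (sphere (0 : V3) 1)) := by
    unfold sphereMeasure; infer_instance
  exact hf.integrable_of_hasCompactSupport (HasCompactSupport.of_compactSpace f)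

/-! ## The cubic half-moment `∫_{S²} (⟪e, ω⟫)₊³ dσ = π / 2` -/

/-- The disc moment `∫_{‖p‖ < 1} (1 − ‖p‖²) dp = π/2` in `ℝ²`. [folklore] -/
theorem integral_disc_one_sub_norm_sq :
    ∫ p in ball (0 : EuclideanSpace ℝ (Fin 2)) 1, (1 - ‖p‖ ^ 2) = Real.pi / 2 := by
  have hint : IntegrableOn (fun p : EuclideanSpace ℝ (Fin 2) => ‖p‖ ^ 2) (ball 0 1) volume :=
    ((continuous_norm.pow 2).continuousOn.integrableOn_compact (isCompact_closedBall 0 1)).mono_set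
      ball_subset_closedBall
  have hvol : (volume (ball (0 : EuclideanSpace ℝ (Fin 2)) 1)).toReal = Real.pi := by
    rw [EuclideanSpace.volume_ball_fin_two, ENNReal.ofReal_one, one_pow, one_mul,
      ENNReal.toReal_ofReal Real.pi_pos.le]
  have hconst : IntegrableOn (fun _ : EuclideanSpace ℝ (Fin 2) => (1 : ℝ)) (ball 0 1) volume :=
    integrableOn_const measure_ball_lt_top.ne
  rw [integral_sub hconst hint, setIntegral_const, integral_ball_norm_sq (d := Fin 2) zero_le_one,
    measureReal_def, hvol]
  simp only [Fintype.card_fin, smul_eq_mul, mul_one, one_pow, Nat.cast_ofNat]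
  ring

/-- **Cubic half-moment of the sphere measure**: `∫_{S²} (⟪e, ω⟫)₊³ dσ(ω) = π/2` for a unit vector
`e` (flux form of the hat-box theorem with `f(p) = 1 − ‖p‖²`). [folklore] -/
theorem integral_posPart_inner_cube {e : V3} (he : ‖e‖ = 1) :
    ∫ ω : sphere (0 : V3) 1, (max ⟪e, (ω : V3)⟫ 0) ^ 3 ∂sphereMeasure = Real.pi / 2 := by
  have hf : Measurable fun p : EuclideanSpace ℝ (Fin 2) => ENNReal.ofReal (1 - ‖p‖ ^ 2) :=
    ENNReal.measurable_ofReal.comp (measurable_const.sub (measurable_norm.pow_const 2))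
  -- the hat-box theorem for `f(p) = 1 - ‖p‖²`
  have hL : ∫⁻ ν : sphere (0 : V3) 1, ENNReal.ofReal ⟪e, (ν : V3)⟫ *
      ENNReal.ofReal (1 - ‖Lambert.coords e ν‖ ^ 2) ∂sphereMeasure =
      ∫⁻ p in ball (0 : EuclideanSpace ℝ (Fin 2)) 1, ENNReal.ofReal (1 - ‖p‖ ^ 2) :=
    lintegral_toSphere_cos_comp_coords he hf
  -- its left side is the cubic half-moment
  have hlhs : ∫⁻ ν : sphere (0 : V3) 1, ENNReal.ofReal ⟪e, (ν : V3)⟫ *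
      ENNReal.ofReal (1 - ‖Lambert.coords e ν‖ ^ 2) ∂sphereMeasure =
      ∫⁻ ν : sphere (0 : V3) 1, ENNReal.ofReal ((max ⟪e, (ν : V3)⟫ 0) ^ 3) ∂sphereMeasure := by
    refine lintegral_congr fun ν => ?_
    have hν : ‖(ν : V3)‖ = 1 := by simp
    rw [Lambert.norm_sq_coords_of_norm_eq_one he hν, sub_sub_cancel]
    rcases le_total 0 ⟪e, (ν : V3)⟫ with h | h
    · rw [max_eq_left h, ← ENNReal.ofReal_mul h]
      congr 1
      ring
    · rw [max_eq_right h, ENNReal.ofReal_of_nonpos h, zero_mul]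
      simp
  -- its right side is `π / 2`
  have hrhs : ∫⁻ p in ball (0 : EuclideanSpace ℝ (Fin 2)) 1, ENNReal.ofReal (1 - ‖p‖ ^ 2) =
      ENNReal.ofReal (Real.pi / 2) := by
    have hint : IntegrableOn (fun p : EuclideanSpace ℝ (Fin 2) => 1 - ‖p‖ ^ 2) (ball 0 1) volume :=
      ((continuous_const.sub (continuous_norm.pow 2)).continuousOn.integrableOn_compact
        (isCompact_closedBall 0 1)).mono_set ball_subset_closedBall
    have hnn : 0 ≤ᵐ[volume.restrict (ball (0 : EuclideanSpace ℝ (Fin 2)) 1)]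
        fun p : EuclideanSpace ℝ (Fin 2) => 1 - ‖p‖ ^ 2 := by
      refine ae_restrict_of_forall_mem measurableSet_ball fun p hp => ?_
      have hp1 : ‖p‖ < 1 := mem_ball_zero_iff.1 hp
      exact sub_nonneg.2 (pow_le_one₀ (norm_nonneg _) hp1.le)
    rw [← ofReal_integral_eq_lintegral_ofReal hint hnn, integral_disc_one_sub_norm_sq]
  rw [integral_eq_lintegral_of_nonneg_ae (ae_of_all _ fun ω => by positivity)
    (Continuous.aestronglyMeasurable (by fun_prop)), ← hlhs, hL, hrhs,
    ENNReal.toReal_ofReal (by positivity)]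

/-! ## The odd part vanishes -/

/-- For `b ⊥ e`, `∫_{S²} ⟪e, ω⟫ ⟪b, ω⟫ (⟪e, ω⟫)₊ dσ = 0`: the reflection in the hyperplane `b^⊥`
preserves `σ`, fixes `⟪e, ω⟫` and flips the sign of `⟪b, ω⟫`. [folklore] -/
theorem integral_odd_part_eq_zero {e b : V3} (hbe : ⟪b, e⟫ = 0) :
    ∫ ω : sphere (0 : V3) 1, ⟪e, (ω : V3)⟫ * ⟪b, (ω : V3)⟫ * max ⟪e, (ω : V3)⟫ 0 ∂sphereMeasure = 0 := by
  have hRe : (ℝ ∙ b)ᗮ.reflection e = e :=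
    Submodule.reflection_mem_subspace_eq_self
      (Submodule.mem_orthogonal_singleton_iff_inner_right.2 hbe)
  have hRb : (ℝ ∙ b)ᗮ.reflection b = -b := Submodule.reflection_orthogonalComplement_singleton_eq_neg b
  have hin : ∀ x y : V3, ⟪x, (ℝ ∙ b)ᗮ.reflection y⟫ = ⟪(ℝ ∙ b)ᗮ.reflection x, y⟫ := fun x y => by
    conv_rhs => rw [← Submodule.reflection_reflection (ℝ ∙ b)ᗮ y]
    exact (((ℝ ∙ b)ᗮ.reflection).inner_map_map x _).symm
  have h := integral_sphere_comp_isometry ((ℝ ∙ b)ᗮ.reflection)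
    (fun ω : sphere (0 : V3) 1 => ⟪e, (ω : V3)⟫ * ⟪b, (ω : V3)⟫ * max ⟪e, (ω : V3)⟫ 0)
  simp only [MapsTo.val_restrict_apply, hin, hRe, hRb, inner_neg_left,
    mul_neg, neg_mul, integral_neg] at h
  linarith

/-! ## The flux-weighted mixed moment -/

/-- **`∫_{S²} ⟪g, ω⟫ ⟪a, ω⟫ (⟪g, ω⟫)₊ dσ = (π/2) ‖g‖ ⟪a, g⟫`** for all `g, a ∈ ℝ³`. [folklore] -/
theorem integral_inner_mul_inner_mul_posPart (g a : V3) :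
    ∫ ω : sphere (0 : V3) 1, ⟪g, (ω : V3)⟫ * ⟪a, (ω : V3)⟫ * max ⟪g, (ω : V3)⟫ 0 ∂sphereMeasure =
      Real.pi / 2 * ‖g‖ * ⟪a, g⟫ := by
  by_cases hg : g = 0
  · subst hg
    simp
  have hgpos : 0 < ‖g‖ := norm_pos_iff.2 hg
  -- the unit vector `e = g / ‖g‖` and the component `b` of `a` orthogonal to it
  obtain ⟨e, hge, he⟩ : ∃ e : V3, g = ‖g‖ • e ∧ ‖e‖ = 1 :=
    ⟨‖g‖⁻¹ • g, by rw [smul_smul, mul_inv_cancel₀ hgpos.ne', one_smul],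
      by rw [norm_smul, norm_inv, norm_norm, inv_mul_cancel₀ hgpos.ne']⟩
  obtain ⟨b, hb⟩ : ∃ b : V3, b = a - ⟪a, e⟫ • e := ⟨_, rfl⟩
  have hbe : ⟪b, e⟫ = 0 := by
    rw [hb, inner_sub_left, real_inner_smul_left, real_inner_self_eq_norm_sq, he]
    ring
  have hgin : ∀ ω : sphere (0 : V3) 1, ⟪g, (ω : V3)⟫ = ‖g‖ * ⟪e, (ω : V3)⟫ := fun ω => by
    conv_lhs => rw [hge]
    rw [real_inner_smul_left]
  have hag : ⟪a, g⟫ = ‖g‖ * ⟪a, e⟫ := by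
    conv_lhs => rw [hge]
    rw [real_inner_smul_right]
  have hain : ∀ ω : sphere (0 : V3) 1, ⟪a, (ω : V3)⟫ = ⟪a, e⟫ * ⟪e, (ω : V3)⟫ + ⟪b, (ω : V3)⟫ := by
    intro ω
    rw [hb, inner_sub_left, real_inner_smul_left]
    ring
  have hdec : ∀ ω : sphere (0 : V3) 1,
      ⟪g, (ω : V3)⟫ * ⟪a, (ω : V3)⟫ * max ⟪g, (ω : V3)⟫ 0 =
        ‖g‖ ^ 2 * ⟪a, e⟫ * (max ⟪e, (ω : V3)⟫ 0) ^ 3 +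
          ‖g‖ ^ 2 * (⟪e, (ω : V3)⟫ * ⟪b, (ω : V3)⟫ * max ⟪e, (ω : V3)⟫ 0) := by
    intro ω
    rw [hain ω, hgin ω]
    rcases le_total 0 ⟪e, (ω : V3)⟫ with h | h
    · rw [max_eq_left h, max_eq_left (mul_nonneg hgpos.le h)]
      ring
    · rw [max_eq_right h, max_eq_right (mul_nonpos_of_nonneg_of_nonpos hgpos.le h)]
      ring
  simp_rw [hdec]
  rw [integral_add (integrable_sph (by fun_prop)) (integrable_sph (by fun_prop)), integral_const_mul,
    integral_const_mul, integral_posPart_inner_cube he, integral_odd_part_eq_zero hbe, mul_zero,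
    add_zero, hag]
  ring

/-! ## The registered stub -/

-- adapted from `Cruxes/RateFloor/IdeatorThreeSketch.lean` (`norm_sq_reflectVel_fst_sub`, ideator 3)
/-- Pointwise form of the equipartition identity: `‖v′‖² − ‖v‖² = ⟪w − v, ω⟫ ⟪v + w, ω⟫` for a unit
impact direction `ω` (adapted from the ideator-3 sketch of the crux). [folklore] -/
theorem norm_sq_reflectVel_fst_sub (ω : Metric.sphere (0 : V3) 1) (v w : V3) :
    ‖(reflectVel (ω : V3) (v, w)).1‖ ^ 2 - ‖v‖ ^ 2 = ⟪w - v, (ω : V3)⟫_ℝ * ⟪v + w, (ω : V3)⟫_ℝ := by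
  have hω : ‖(ω : V3)‖ = 1 := norm_eq_of_mem_sphere ω
  have key : (reflectVel (ω : V3) (v, w)).1 = v - ⟪v - w, (ω : V3)⟫_ℝ • (ω : V3) := by
    simp only [reflectVel, hω, one_pow, div_one]
  rw [key, @norm_sub_sq_real, norm_smul, Real.norm_eq_abs, hω, mul_one, sq_abs, inner_smul_right,
    inner_sub_left, inner_sub_left, inner_add_left]
  ring

/-- **S4 · Collision equipartition** (registered stub `stub_collisionEquipartition` of the line `Sketch`
of crux `JParityClosure.RateFloor`): averaged over the impact geometry with the hard-sphere rate
`((w − v)·ω)₊ dσ(ω)`, one collision hands particle 1 exactly half the kinetic-energy gap,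
`∫_{S²} (‖v′‖² − ‖v‖²) ((w − v)·ω)₊ dσ(ω) = (π/2) ‖w − v‖ (‖w‖² − ‖v‖²)`. [folklore] -/
theorem stub_collisionEquipartition :
    ∀ v w : V3,
    ∫ ω : Metric.sphere (0 : V3) 1,
        (‖(reflectVel (ω : V3) (v, w)).1‖ ^ 2 - ‖v‖ ^ 2) * hardSphereKernel (w, v) ω ∂sphereMeasure
      = Real.pi / 2 * ‖w - v‖ * (‖w‖ ^ 2 - ‖v‖ ^ 2) := by
  intro v w
  have hpt : (fun ω : Metric.sphere (0 : V3) 1 =>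
      (‖(reflectVel (ω : V3) (v, w)).1‖ ^ 2 - ‖v‖ ^ 2) * hardSphereKernel (w, v) ω) =
      fun ω : Metric.sphere (0 : V3) 1 =>
        ⟪w - v, (ω : V3)⟫ * ⟪v + w, (ω : V3)⟫ * max ⟪w - v, (ω : V3)⟫ 0 := by
    funext ω
    rw [norm_sq_reflectVel_fst_sub]
    rfl
  have hinner : ⟪v + w, w - v⟫ = ‖w‖ ^ 2 - ‖v‖ ^ 2 := by
    rw [inner_add_left, inner_sub_right, inner_sub_right, real_inner_self_eq_norm_sq,
      real_inner_self_eq_norm_sq, real_inner_comm v w]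
    ring
  rw [hpt, integral_inner_mul_inner_mul_posPart (w - v) (v + w), hinner]

end RateFloorCollisionEquipartition

end Summit.AtomisticToContinuum.HydrodynamicLimit.Theorems

end
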